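import Summits.Ventures.CertifiedManyBodySolver.Downfold.EmeryFermiEnergyOf
import HarnessLib

/-!
# THE CHARGE-TRANSFER LEVER IS 1-LIPSCHITZ: raising `Δ` by `δ ≥ 0` lowers every antibonding state by at most `δ`, shifts the filling
# map by at most `δ`, and LOWERS the Fermi energy of every filling by at most `δ` — a certified modulus in the least certain parameter

Venture CertifiedManyBodySolver, cell `pub/hubbard-downfold` (stage S1; INFLATION-RULES-3to1-B §B.83 (f)), seat hubbard-downfold-mod-4 (technique B,
g34); namespace `Summit.Ventures.CertifiedManyBodySolver.Downfold.Emery`. Everything PROVED (0 sorry, no definition). WHAT THIS IS NOT: a statement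
about any material; `U = 0` one-body kinematics of the σ (d–p_x–p_y + t_pp, t_pp′) model (electron picture, `ε_d = 0`, `ε_p = −Δ`).

`EmeryFermiEnergyStable` proves the Fermi energy moves CONTINUOUSLY with the row but certifies no modulus. For the charge-transfer energy
`Δ = ε_d − ε_p` — the three-band coordinate on which typed constructions of ONE material differ most (La₂CuO₄: 2.6 … 3.7 eV across cLDA /
Wannier / cGW-SIC rows) — the modulus is EXACTLY ONE, by two determinant identities and no analysis:

* §1 `charCubic_Delta_shift_diag`: `charCubic(Δ + δ; t − δ) = charCubic(Δ; t) − δ·minorD(Δ; t)` (the matrix-determinant lemma for the rank-one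
  update `H(Δ + δ) = (H(Δ) − δ·1) + δ·e_d e_dᵀ`, here `ring`), beside §B.81's `charCubic_shift_Delta`:
  `charCubic(Δ + δ; t) = charCubic(Δ; t) + δ·(minorX + minorY)(t) + δ²t`.
* §2 **THE BAND IS NON-INCREASING AND 1-LIPSCHITZ IN Δ**: for `δ ≥ 0` (and `Δ, t_pp, t_pp′, x, y ≥ 0`),
  **`ε_AB(Δ; x, y) − δ ≤ ε_AB(Δ + δ; x, y) ≤ ε_AB(Δ; x, y)`** (`abBand_sub_le_abBand_shift`, `abBand_shift_le_abBand`: evaluate the two identities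
  at `t = ε_AB(Δ)`, where the three principal minors are `≥ 0`, and read the signs with the enclosure criteria — lowering the oxygen level lowers
  every antibonding state, by no more than the level moved; pointwise form of the Hellmann–Feynman slope `dε/dΔ = −(1 − w_d) ∈ [−1, 0]` of §B.81).
* §3 THE FILLING MAP SHIFTS BY AT MOST δ: `abFilling(Δ; ε) ≤ abFilling(Δ + δ; ε) ≤ abFilling(Δ; ε + δ)` (`abFilling_le_abFilling_shift`,
  `abFilling_shift_le_abFilling_add`).
* §4 **THE FERMI ENERGY IS NON-INCREASING AND 1-LIPSCHITZ IN Δ**: for every filling `0 < ν < 1` attained at both rows,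
  **`fermiEnergyOf(Δ; ν) − δ ≤ fermiEnergyOf(Δ + δ; ν) ≤ fermiEnergyOf(Δ; ν)`** (`fermiEnergyOf_shift_le`, `fermiEnergyOf_sub_le_shift`,
  `abs_fermiEnergyOf_shift_sub_le`): a 1-eV disagreement in Δ between two constructions moves the σ-row Fermi energy (measured from `ε_d`)
  by at most 1 eV downward, with no certificate — the quantitative companion of `EmeryFermiEnergyStable`.

Sources: three-band model [HybertsenSchluterChristensen1989, Eq. (1)]; matrix determinant lemma / Weyl monotonicity [folklore].
-/

noncomputable section

namespace Summit.Ventures.CertifiedManyBodySolver.Downfold.Emery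

open Real MeasureTheory Set

/-! ## §1 The diagonal Δ-shift identity -/

/-- **`charCubic(Δ + δ; x, y; t − δ) = charCubic(Δ; x, y; t) − δ·minorD(Δ; x, y; t)`** (rank-one determinant lemma; `ring`). [folklore] -/
theorem charCubic_Delta_shift_diag (Δ a b c x y t δ : ℝ) :
    charCubic (Δ + δ) a b c x y (t - δ) = charCubic Δ a b c x y t - δ * minorD Δ b c x y t := by
  unfold charCubic minorD; ring

/-! ## §2 The antibonding band is non-increasing and 1-Lipschitz in Δ -/

section Band

variable {Δ a b c x y δ : ℝ}

/-- **Raising Δ lowers the antibonding band: `ε_AB(Δ + δ) ≤ ε_AB(Δ)`** for `δ ≥ 0` (`Δ > 0`, `t_pd ≠ 0`, `t_pp, t_pp′, x, y ≥ 0`). [folklore] -/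
theorem abBand_shift_le_abBand (hΔ : 0 < Δ) (ha : a ≠ 0) (hc : 0 ≤ c) (hb : 0 ≤ b) (hx : 0 ≤ x) (hy : 0 ≤ y) (hδ : 0 ≤ δ) :
    abBand (Δ + δ) a b c x y ≤ abBand Δ a b c x y := by
  by_cases hxy : 0 < x + y
  · set E := abBand Δ a b c x y with hE
    have hEpos : 0 < E := abBand_pos_of_sum_pos hΔ ha hc hb hx hy hxy
    have hP := charCubic_abBand Δ a b c x y
    have hX := minorX_nonneg_of_contour hΔ.le hc hb hx hy hEpos hP
    have hY := minorY_nonneg_of_contour hΔ.le hc hb hx hy hEpos hP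
    have hval : 0 ≤ charCubic (Δ + δ) a b c x y E := by
      rw [charCubic_shift_Delta, hP]
      have : 0 ≤ δ * (minorX Δ a c y E + minorY Δ a c x E) := mul_nonneg hδ (by linarith)
      have : 0 ≤ δ ^ 2 * E := by positivity
      linarith
    by_contra hlt
    push Not at hlt
    have := charCubic_neg_of_pos_of_lt_abBand (by linarith) hc hb hx hy hEpos hlt
    linarith
  · have hx0 : x = 0 := by linarith
    have hy0 : y = 0 := by linarith
    rw [hx0, hy0, abBand_Gamma hΔ.le, abBand_Gamma (by linarith)]

/-- **… by at most `δ`: `ε_AB(Δ) − δ ≤ ε_AB(Δ + δ)`** for `δ ≥ 0` (`Δ, t_pp, t_pp′, x, y ≥ 0`). [folklore] -/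
theorem abBand_sub_le_abBand_shift (hΔ : 0 ≤ Δ) (hc : 0 ≤ c) (hb : 0 ≤ b) (hx : 0 ≤ x) (hy : 0 ≤ y) (hδ : 0 ≤ δ) :
    abBand Δ a b c x y - δ ≤ abBand (Δ + δ) a b c x y := by
  set E := abBand Δ a b c x y with hE
  have hE0 : 0 ≤ E := abBand_nonneg (tpd := a) hΔ hc hb hx hy
  rcases hE0.lt_or_eq with hEpos | hEzero
  · have hP := charCubic_abBand Δ a b c x y
    have hD := minorD_nonneg_of_contour hΔ hc hb hx hy hEpos hP
    apply le_abBand_of_charCubic_nonpos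
    rw [charCubic_Delta_shift_diag, hP]
    nlinarith
  · rw [← hEzero]
    have := abBand_nonneg (tpd := a) (show 0 ≤ Δ + δ by linarith) hc hb hx hy
    linarith

/-- The two bounds as one bracket. [folklore] -/
theorem abBand_shift_mem_Icc (hΔ : 0 < Δ) (ha : a ≠ 0) (hc : 0 ≤ c) (hb : 0 ≤ b) (hx : 0 ≤ x) (hy : 0 ≤ y) (hδ : 0 ≤ δ) :
    abBand (Δ + δ) a b c x y ∈ Icc (abBand Δ a b c x y - δ) (abBand Δ a b c x y) :=
  ⟨abBand_sub_le_abBand_shift hΔ.le hc hb hx hy hδ, abBand_shift_le_abBand hΔ ha hc hb hx hy hδ⟩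

end Band

/-! ## §3 The filling map shifts by at most δ -/

section Filling

variable {Δ a b c δ : ℝ}

/-- Raising Δ can only ADD occupied states at fixed energy: `abFilling(Δ; ε) ≤ abFilling(Δ + δ; ε)`. [folklore] -/
theorem abFilling_le_abFilling_shift (hΔ : 0 < Δ) (ha : a ≠ 0) (hc : 0 ≤ c) (hb : 0 ≤ b) (hδ : 0 ≤ δ) (ε : ℝ) :
    abFilling Δ a b c ε ≤ abFilling (Δ + δ) a b c ε := by
  unfold abFilling
  refine div_le_div_of_nonneg_right ?_ (by positivity)
  refine ENNReal.toReal_mono (volume_abOccSet_ne_top _ _ _ _ _) (measure_mono ?_)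
  intro k hk
  exact ⟨hk.1, le_trans (abBand_shift_le_abBand hΔ ha hc hb (halfSq_nonneg _) (halfSq_nonneg _) hδ) hk.2⟩

/-- … and never more than an energy shift `δ` would: `abFilling(Δ + δ; ε) ≤ abFilling(Δ; ε + δ)`. [folklore] -/
theorem abFilling_shift_le_abFilling_add (hΔ : 0 ≤ Δ) (hc : 0 ≤ c) (hb : 0 ≤ b) (hδ : 0 ≤ δ) (ε : ℝ) :
    abFilling (Δ + δ) a b c ε ≤ abFilling Δ a b c (ε + δ) := by
  unfold abFilling
  refine div_le_div_of_nonneg_right ?_ (by positivity)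
  refine ENNReal.toReal_mono (volume_abOccSet_ne_top _ _ _ _ _) (measure_mono ?_)
  intro k hk
  refine ⟨hk.1, ?_⟩
  have := abBand_sub_le_abBand_shift (a := a) hΔ hc hb (halfSq_nonneg k.1) (halfSq_nonneg k.2) hδ
  have h2 : abBand (Δ + δ) a b c (halfSq k.1) (halfSq k.2) ≤ ε := hk.2
  show abBand Δ a b c (halfSq k.1) (halfSq k.2) ≤ ε + δ
  linarith

end Filling

/-! ## §4 The Fermi energy is non-increasing and 1-Lipschitz in Δ -/

section Fermi

variable {Δ a b c δ ν : ℝ}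

/-- **Raising Δ lowers the Fermi energy of every filling: `ε_F(Δ + δ; ν) ≤ ε_F(Δ; ν)`** (`0 < ν < 1` attained at both rows). [folklore] -/
theorem fermiEnergyOf_shift_le (hΔ : 0 < Δ) (ha : a ≠ 0) (hc : 0 ≤ c) (hb : 0 ≤ b) (hδ : 0 ≤ δ) (hν0 : 0 < ν) (hν1 : ν < 1)
    (hex : ∃ ε : ℝ, abFilling Δ a b c ε = ν) (hex' : ∃ ε : ℝ, abFilling (Δ + δ) a b c ε = ν) :
    fermiEnergyOf (Δ + δ) a b c ν ≤ fermiEnergyOf Δ a b c ν := by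
  have hΔ' : 0 ≤ Δ + δ := by linarith
  have h : abFilling Δ a b c (fermiEnergyOf Δ a b c ν) = ν := abFilling_fermiEnergyOf hΔ.le hc hb hν0 hν1 hex
  have h' : abFilling (Δ + δ) a b c (fermiEnergyOf (Δ + δ) a b c ν) = ν := abFilling_fermiEnergyOf hΔ' hc hb hν0 hν1 hex'
  by_contra hlt
  push Not at hlt
  obtain ⟨k, hk, hkE⟩ := exists_gt_of_abFilling_lt_one (Δ := Δ + δ) (a := a) (b := b) (c := c)
    (ε := fermiEnergyOf (Δ + δ) a b c ν) (by rw [h']; exact hν1)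
  have hstrict := abFilling_lt_abFilling (a := a) hΔ' hc hb (fermiEnergyOf_nonneg hΔ.le hc hb hν0 hν1 hex) hlt hk hkE.le
  have hmono := abFilling_le_abFilling_shift hΔ ha hc hb hδ (fermiEnergyOf Δ a b c ν)
  linarith

/-- **… by at most `δ`: `ε_F(Δ; ν) − δ ≤ ε_F(Δ + δ; ν)`.** [folklore] -/
theorem fermiEnergyOf_sub_le_shift (hΔ : 0 ≤ Δ) (hc : 0 ≤ c) (hb : 0 ≤ b) (hδ : 0 ≤ δ) (hν0 : 0 < ν) (hν1 : ν < 1)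
    (hex : ∃ ε : ℝ, abFilling Δ a b c ε = ν) (hex' : ∃ ε : ℝ, abFilling (Δ + δ) a b c ε = ν) :
    fermiEnergyOf Δ a b c ν - δ ≤ fermiEnergyOf (Δ + δ) a b c ν := by
  have hΔ' : 0 ≤ Δ + δ := by linarith
  have h : abFilling Δ a b c (fermiEnergyOf Δ a b c ν) = ν := abFilling_fermiEnergyOf hΔ hc hb hν0 hν1 hex
  have h' : abFilling (Δ + δ) a b c (fermiEnergyOf (Δ + δ) a b c ν) = ν := abFilling_fermiEnergyOf hΔ' hc hb hν0 hν1 hex'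
  by_contra hlt
  push Not at hlt
  have hlt' : fermiEnergyOf (Δ + δ) a b c ν + δ < fermiEnergyOf Δ a b c ν := by linarith
  obtain ⟨k, hk, hkE⟩ := exists_gt_of_abFilling_lt_one (Δ := Δ) (a := a) (b := b) (c := c)
    (ε := fermiEnergyOf Δ a b c ν) (by rw [h]; exact hν1)
  have h0 : 0 ≤ fermiEnergyOf (Δ + δ) a b c ν + δ := by
    have := fermiEnergyOf_nonneg hΔ' hc hb hν0 hν1 hex'; linarith
  have hstrict := abFilling_lt_abFilling (a := a) hΔ hc hb h0 hlt' hk hkE.le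
  have hshift := abFilling_shift_le_abFilling_add (a := a) hΔ hc hb hδ (fermiEnergyOf (Δ + δ) a b c ν)
  linarith

/-- **THE FERMI ENERGY IS 1-LIPSCHITZ IN THE CHARGE-TRANSFER ENERGY**: `|ε_F(Δ + δ; ν) − ε_F(Δ; ν)| ≤ δ` for `δ ≥ 0`. [folklore] -/
theorem abs_fermiEnergyOf_shift_sub_le (hΔ : 0 < Δ) (ha : a ≠ 0) (hc : 0 ≤ c) (hb : 0 ≤ b) (hδ : 0 ≤ δ) (hν0 : 0 < ν) (hν1 : ν < 1)
    (hex : ∃ ε : ℝ, abFilling Δ a b c ε = ν) (hex' : ∃ ε : ℝ, abFilling (Δ + δ) a b c ε = ν) :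
    |fermiEnergyOf (Δ + δ) a b c ν - fermiEnergyOf Δ a b c ν| ≤ δ := by
  have h1 := fermiEnergyOf_shift_le hΔ ha hc hb hδ hν0 hν1 hex hex'
  have h2 := fermiEnergyOf_sub_le_shift hΔ.le hc hb hδ hν0 hν1 hex hex'
  rw [abs_le]; constructor <;> linarith

end Fermi

end Summit.Ventures.CertifiedManyBodySolver.Downfold.Emery
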